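import Summits.CriticalPhenomena.SAWScalingLimit.Theorems.SAWDevelopingMapObservableToSLETypeLadderCarvedReductionTranslation
import Literature.Probability.Percolation.SitePaths
import HarnessLib

/-!
# The outer containment from the closure clause (piece (G5-contain) of stub T2b″)

Crux `SAWDevelopingMap.ObservableToSLE` (stmt-CriticalPhenomena-10472), line `six-class-type-ladder`,
stub T2b″ `stub_carvedReduction_squeezeSolid`.  Landing target:
`Summits/CriticalPhenomena/SAWScalingLimit/Theorems/SAWDevelopingMapObservableToSLETypeLadderCarvedReductionSqueezeContain.lean`
(`--supports stmt-CriticalPhenomena-10472`).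

The ratio squeeze (`TypeLadder.stub_carvedReduction_ratioSqueeze`, p131716) needs the OUTER
CONTAINMENT: every walk of `Ω_δ` from the gate vertex `q` avoiding the removed set `U` stays, after
translating back by the pinning translation `x`, inside the outer family `N`.  The two-piece family
(`TypeLadder.twoPiece_exists_innerFamily`, p134423) is CLOSED under lattice paths through clearly-deep
vertices; so the containment reduces to: the translated gate vertex is in `N`, and every vertex met
by such a walk is, translated, clearly deep.  This file is that reduction, for an abstract set `C`
of admissible vertices and the translation `w ↦ (-x + w.1, w.2)` (`walk_translate_subset_of_closed`,
registered as `stub_carvedReduction_outerContainment`): induction along the walk, translating each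
edge (`hexGraph_adj_translate_iff`) into a one-step `PathIn` chain in `C`.
-/

noncomputable section

open Literature.Probability.LatticeModels (HexVertex hexGraph hexCenter Site)
open Literature.Probability.RandomPlanarGeometry
open Literature.Probability.RandomPlanarGeometry.SAW
open Literature.Probability.Percolation (PathIn)

namespace Summit.CriticalPhenomena.SAWScalingLimit.Theorems.ObservableToSLE.TypeLadder

/-- **Containment of translated walks from the closure clause.**  Let `N` be closed under `PathIn`
chains through `C` (`z ∈ N`, `PathIn hexGraph C z w` ⇒ `w ∈ N`).  If a walk of a subgraph `G ≤ hexGraph`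
starts at a vertex whose translate lies in `N` and all its vertices translate into `C`, then all
its vertices translate into `N`. -/
theorem walk_translate_subset_of_closed {G : SimpleGraph HexVertex} (hG : G ≤ hexGraph)
    {N C : Set HexVertex} (hclosed : ∀ z w : HexVertex, z ∈ N → PathIn hexGraph C z w → w ∈ N)
    (x : Site 2) {u w : HexVertex} (π : G.Walk u w)
    (hu : ((-x + u.1, u.2) : HexVertex) ∈ N)
    (hC : ∀ y ∈ π.support, ((-x + y.1, y.2) : HexVertex) ∈ C) :
    ∀ y ∈ π.support, ((-x + y.1, y.2) : HexVertex) ∈ N := by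
  induction π with
  | nil =>
    intro y hy
    rw [SimpleGraph.Walk.support_nil, List.mem_singleton] at hy
    subst hy
    exact hu
  | @cons a b c hab π' ih =>
    intro y hy
    rw [SimpleGraph.Walk.support_cons, List.mem_cons] at hy
    have haC : ((-x + a.1, a.2) : HexVertex) ∈ C := hC a (by simp)
    have hbC : ((-x + b.1, b.2) : HexVertex) ∈ C := hC b (by simp)
    have hadj : hexGraph.Adj ((-x + a.1, a.2) : HexVertex) ((-x + b.1, b.2) : HexVertex) :=
      (hexGraph_adj_translate_iff (-x) a b).2 (hG hab)
    have hbN : ((-x + b.1, b.2) : HexVertex) ∈ N := hclosed _ _ hu (PathIn.of_adj haC hbC hadj)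
    rcases hy with rfl | hy
    · exact hu
    · exact ih hbN (fun z hz => hC z (by simp [hz])) y hy

/-- **THE OUTER CONTAINMENT** (form consumed by the ratio squeeze): if the translated gate vertex is
in `N`, `N` is closed under chains through `C`, and every `U`-avoiding walk of `Ω_δ` from the gate
translates into `C`, then every `U`-avoiding walk of `Ω_δ` from the gate translates into `N`. -/
theorem outerContainment {Ω : Set ℂ} {δ : ℝ} {U : Set HexVertex} {N C : Set HexVertex} {x : Site 2}
    {q : HexVertex} (hclosed : ∀ z w : HexVertex, z ∈ N → PathIn hexGraph C z w → w ∈ N)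
    (hq : ((-x + q.1, q.2) : HexVertex) ∈ N)
    (hC : ∀ (w : HexVertex) (π : (hexDomainGraph Ω δ).Walk q w), (∀ y ∈ π.support, y ∉ U) →
      ∀ y ∈ π.support, ((-x + y.1, y.2) : HexVertex) ∈ C) :
    ∀ (w : HexVertex) (π : (hexDomainGraph Ω δ).Walk q w), (∀ y ∈ π.support, y ∉ U) →
      ∀ y ∈ π.support, ((-x + y.1, y.2) : HexVertex) ∈ N :=
  fun w π hπ => walk_translate_subset_of_closed (embDomainGraph_le hexGraph hexCenter Ω δ) hclosed x π hq
    (hC w π hπ)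

/-- **Registered sub-goal `stub_carvedReduction_outerContainment`** (crux item stmt-CriticalPhenomena-10472,
stub T2b″ `stub_carvedReduction_squeezeSolid`, piece (G5-contain) THE OUTER CONTAINMENT FROM THE CLOSURE
CLAUSE): registry form of `outerContainment` with `N` a finset (as in the squeeze package). -/
theorem stub_carvedReduction_outerContainment :
    ∀ (Ω : Set ℂ) (δ : ℝ) (U C : Set HexVertex) (N : Finset HexVertex) (x : Site 2) (q : HexVertex),
      (∀ z w : HexVertex, z ∈ N → PathIn hexGraph C z w → w ∈ N) →
      ((-x + q.1, q.2) : HexVertex) ∈ N →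
      (∀ (w : HexVertex) (π : (hexDomainGraph Ω δ).Walk q w), (∀ y ∈ π.support, y ∉ U) →
        ∀ y ∈ π.support, ((-x + y.1, y.2) : HexVertex) ∈ C) →
      ∀ (w : HexVertex) (π : (hexDomainGraph Ω δ).Walk q w), (∀ y ∈ π.support, y ∉ U) →
        ∀ y ∈ π.support, ((-x + y.1, y.2) : HexVertex) ∈ N := by
  intro Ω δ U C N x q hclosed hq hC w π hπ y hy
  have h := outerContainment (N := (↑N : Set HexVertex)) (fun z w hz hzw => hclosed z w hz hzw) hq hC w π hπ y hy
  exact h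

end Summit.CriticalPhenomena.SAWScalingLimit.Theorems.ObservableToSLE.TypeLadder

end
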